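import Literature.MathematicalPhysics.QuantumFieldTheory.ConformalBootstrap3D.PointKernelK57Data

/-!
# K57 certificate, kernel block file H16: head segments `124 ≤ i < 129` (block-checked ones)

`decide` by kernel reduction (no `native_decide`, no extra axioms) of the block checker
`PCert.hBlockOK` of `PointKernel` on the literal data of `PointKernelK57Data` (cells checked corner
or chord by the rule bit); soundness is `PCert.hBlockOK_sound`.  Estimated kernel time 184 s
(5 theorems).
-/

set_option maxRecDepth 100000
set_option maxHeartbeats 0

namespace Literature.MathematicalPhysics.QuantumFieldTheory.ConformalBootstrap3D.PointKernelK57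

open Literature.MathematicalPhysics.QuantumFieldTheory.ConformalBootstrap3D.PointKernel

/-- head segment `[124, 125)` passes the kernel evaluator (≈24 s of kernel work). [folklore] -/
theorem hBlock_124 : certK57.hBlockOK hsegsK57 124 125 JHK57 = true := by
  decide +kernel

/-- head segment `[125, 126)` passes the kernel evaluator (≈24 s of kernel work). [folklore] -/
theorem hBlock_125 : certK57.hBlockOK hsegsK57 125 126 JHK57 = true := by
  decide +kernel

/-- head segment `[126, 127)` passes the kernel evaluator (≈24 s of kernel work). [folklore] -/
theorem hBlock_126 : certK57.hBlockOK hsegsK57 126 127 JHK57 = true := by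
  decide +kernel

/-- head segment `[127, 128)` passes the kernel evaluator (≈39 s of kernel work). [folklore] -/
theorem hBlock_127 : certK57.hBlockOK hsegsK57 127 128 JHK57 = true := by
  decide +kernel

/-- head segment `[128, 129)` passes the kernel evaluator (≈35 s of kernel work). [folklore] -/
theorem hBlock_128 : certK57.hBlockOK hsegsK57 128 129 JHK57 = true := by
  decide +kernel

end Literature.MathematicalPhysics.QuantumFieldTheory.ConformalBootstrap3D.PointKernelK57
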